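import Literature.Analysis.FluidPDE.SereginSverakOffAxisTools
import Literature.Analysis.FluidPDE.SereginSverakSuitableProofs
import Literature.Analysis.FluidPDE.NSBoundedHigherRegularity
import Literature.Analysis.FluidPDE.AxisymmetricVorticityTransport
import HarnessLib

/-!
# Seregin–Šverák 2009, (as15): the off-axis smooth representative, from interior regularity

Proofs-only companion of `SereginSverakOffAxisInputs.lean` (G. Seregin, V. Šverák, *On Type I
singularities of the local axi-symmetric solutions of the Navier–Stokes equations*, Comm. PDE 34
(2009) 171–201 = arXiv:0804.1803). That file vendors, as the named fact
`SereginSverak2009.OffAxisSmoothRepresentative`, the regularity under which Seregin–Šverák apply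
Prop. 4.1 of Seregin–Zajaczkowski 2007 to the rescaled pairs in the proof of Prop. 3.7 ((as15),
arXiv p. 10): every pair of the unit-scale class `IsTypeIAxisymmetricSolutionOn 3` has a
representative `V` of the velocity, `u = V` a.e. on the shell `Q̃ = 𝒞(1/4, 3; 2) × ]-2², 0[`, with
`(V, p)` in the hypothesis class `SereginZajaczkowski2007.IsSmoothAxisymmetricSolutionOn` of
Prop. 4.1 on `Q̃`. Its docstring names the source of that regularity: §2 p. 8 of the paper —
inside the region where the velocity is essentially bounded, "for any natural `k`,
`z = (x,t) ↦ ∇ᵏv(z)` is Hölder continuous" ([ESS4], [LS], [NRS]) — applied around every point of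
`Q̃`, where the Type I bound (r3) `√(-t) |u| ≤ C` bounds `u` (the times of `Q̃` are `< 0`).

This file PROVES exactly that reduction:

`offAxisSmoothRepresentative_of_higherRegularity :
  NSBoundedHigherRegularity → OffAxisSmoothRepresentative`,

where `NSBoundedHigherRegularity` (`NSBoundedHigherRegularity.lean`) is the generic named fact
transcribing the quoted passage (bounded distributional solutions with `L_{3/2}` pressure have
`C^∞` slices with all spatial derivatives Hölder continuous in space–time inside). The steps:

* `Q̃ ⊆ Q(0, 3)` and, around each point `z₀ = (t₀, x₀)` of `Q(0, 3)` (`t₀ < 0`), the Type I bound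
  gives `|u| ≤ C / √(-t₀/2)` a.e. on the neighbourhood `Q(0,3) ∩ {t < t₀/2}`
  (`IsTypeIAxisymmetricSolutionOn.exists_nhds_bound`); `p ∈ L_{3/2}(Q(0, 3))` by hypothesis;
* hence (`NSBoundedHigherRegularity.exists_smooth_representative`, the local-to-global form of the
  fact on the open set `Q̃`) one representative `V` on `Q̃`, continuous, with `C^∞` slices and
  locally Hölder spatial derivatives — the fields `contDiffAt` and `holder` of the class;
* `suitable`: the pair is a suitable weak solution on `Q(0, 3)` (Remark 3.4, proved:
  `SuitableOfBounded_holds` and `IsTypeIAxisymmetricSolutionOn.isSuitable`), restricted to `Q̃`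
  and transported to the a.e.-equal `V` (`IsSuitableWeakSolutionOn.congr_ae`);
* `axisymmetric`: the slices of `u` are axisymmetric pointwise, the space–time rotation
  `(t, x) ↦ (t, R_θ x)` preserves Lebesgue measure and `Q̃`, so `V(t, R_θ x) = R_θ V(t, x)` a.e.
  on `Q̃`, hence everywhere on `Q̃` by continuity (`Measure.eqOn_open_of_ae_eq`; the argument of
  the accepted `SereginSverak2009.repr_rotZ`).

When `NSBoundedHigherRegularity_holds` lands, `OffAxisSmoothRepresentative_holds` is the term
`offAxisSmoothRepresentative_of_higherRegularity NSBoundedHigherRegularity_holds`.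

## References

* G. Seregin, V. Šverák, Comm. PDE 34 (2009), arXiv:0804.1803: §2 p. 6 (suitability), p. 8
  (regularity inside the region of essential boundedness), §3 (Thm. 3.1, (r3), Remark 3.4,
  p. 9), proof of Prop. 3.7 ((as15), p. 10). [`SereginSverak2009`]
* G. Seregin, W. Zajaczkowski, SIAM J. Math. Anal. 39 (2007), arXiv:math/0702720: Prop. 4.1 and
  §3 p. 4, §5 p. 8 ("sufficiently smooth"). [`SereginZajaczkowski2007`]
-/

noncomputable section

open MeasureTheory Set Function Filter Topology TopologicalSpace Metric
open scoped NNReal ENNReal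

namespace Literature.Analysis.FluidPDE

namespace SereginSverak2009

open SereginZajaczkowski2007

/-! ### Geometry: the shell inside `Q(0, 3)`, and its rotation invariance -/

/-- `Q̃ = 𝒞(1/4, 3; 2) × ]-2², 0[ ⊆ Q(0, 3)`. [cite: SereginSverak2009, proof of Prop. 3.7 (arXiv p. 10)] -/
theorem shellCyl_tilde_subset_parCyl_three : shellCyl (1 / 4) 3 2 2 ⊆ parCyl (0 : ℝ × (EuclideanSpace ℝ (Fin 3))) 3 := by
  rw [← outerShell_one_eq]
  exact outerShell_one_subset

/-- The same inclusion for the open sets. [folklore] -/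
theorem shellCylOpens_tilde_le_parCylOpens_three :
    shellCylOpens (1 / 4) 3 2 2 ≤ parCylOpens (0 : ℝ × (EuclideanSpace ℝ (Fin 3))) 3 :=
  shellCyl_tilde_subset_parCyl_three

/-- The shell cylinders are invariant under the space–time rotations `(t, x) ↦ (t, R_θ x)`.
[folklore] -/
theorem rotZ_mem_shellCyl_iff {R₁ R₂ a b : ℝ} (θ : ℝ) (z : ℝ × (EuclideanSpace ℝ (Fin 3))) :
    (z.1, rotZ θ z.2) ∈ shellCyl R₁ R₂ a b ↔ z ∈ shellCyl R₁ R₂ a b := by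
  simp only [shellCyl, mem_setOf_eq, rotZ_mem_shell_iff]

/-! ### The Type I bound makes the velocity locally bounded below the top time -/

section TypeI

variable {R : ℝ} {u : ℝ → (EuclideanSpace ℝ (Fin 3)) → (EuclideanSpace ℝ (Fin 3))} {p : ℝ → (EuclideanSpace ℝ (Fin 3)) → ℝ}

/-- **(r3) ⇒ local boundedness** (Seregin–Šverák 2009, §3: (r3) `|v| ≤ C/√(-t)` implies (r2)
`v ∈ L_∞(B × ]-1, -a²[)`; here pointwise in the centre): around every point `z₀ = (t₀, x₀)` of
`Q(0, R)` — so `t₀ < 0` — the velocity of a pair of the class `IsTypeIAxisymmetricSolutionOn R`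
is essentially bounded, namely by `C / √(-t₀/2)` on `Q(0, R) ∩ {t < t₀/2}`.
[cite: SereginSverak2009, §3 ((r3) ⇒ (r2), arXiv p. 9)] -/
theorem IsTypeIAxisymmetricSolutionOn.exists_nhds_bound (h : IsTypeIAxisymmetricSolutionOn R u p)
    {z : ℝ × (EuclideanSpace ℝ (Fin 3))} (hz : z ∈ parCyl (0 : ℝ × (EuclideanSpace ℝ (Fin 3))) R) :
    ∃ U ∈ 𝓝 z, ∃ M : ℝ, ∀ᵐ w ∂(volume.restrict U), ‖u w.1 w.2‖ ≤ M := by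
  obtain ⟨C, hC⟩ := h.typeI
  have hz0 : z.1 < 0 := by
    rw [mem_parCyl_zero] at hz
    exact hz.1.2
  set U : Set (ℝ × (EuclideanSpace ℝ (Fin 3))) := parCyl 0 R ∩ {w | w.1 < z.1 / 2} with hU
  have hUo : IsOpen U := (isOpen_parCyl 0 R).inter (isOpen_lt continuous_fst continuous_const)
  have hzU : z ∈ U := ⟨hz, by show z.1 < z.1 / 2; linarith⟩
  set s₀ : ℝ := Real.sqrt (-(z.1 / 2)) with hs₀
  have hs₀pos : 0 < s₀ := Real.sqrt_pos.2 (by linarith)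
  refine ⟨U, hUo.mem_nhds hzU, C / s₀, ?_⟩
  have h1 : ∀ᵐ w ∂(volume.restrict U), Real.sqrt (-w.1) * ‖u w.1 w.2‖ ≤ C :=
    ae_restrict_of_ae_restrict_of_subset inter_subset_left hC
  filter_upwards [h1, ae_restrict_mem hUo.measurableSet] with w hw hwU
  have hw2 : w.1 < z.1 / 2 := hwU.2
  have hsw : s₀ ≤ Real.sqrt (-w.1) := Real.sqrt_le_sqrt (by linarith)
  rw [le_div_iff₀ hs₀pos]
  calc ‖u w.1 w.2‖ * s₀ ≤ ‖u w.1 w.2‖ * Real.sqrt (-w.1) := by gcongr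
    _ = Real.sqrt (-w.1) * ‖u w.1 w.2‖ := mul_comm _ _
    _ ≤ C := hw

/-- The pressure of a pair of the class is `L_{3/2}` on the neighbourhood `Q(0, R)` of each of its
points. [cite: SereginSverak2009, Thm. 3.1 (q ∈ L_{3/2}(Q))] -/
theorem IsTypeIAxisymmetricSolutionOn.exists_nhds_pressure
    (h : IsTypeIAxisymmetricSolutionOn R u p) {z : ℝ × (EuclideanSpace ℝ (Fin 3))} (hz : z ∈ parCyl (0 : ℝ × (EuclideanSpace ℝ (Fin 3))) R) :
    ∃ U ∈ 𝓝 z, ∫⁻ w in U, ‖p w.1 w.2‖ₑ ^ (3 / 2 : ℝ) < ∞ :=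
  ⟨parCyl 0 R, (isOpen_parCyl 0 R).mem_nhds hz, h.pressure_L32⟩

end TypeI

/-! ### Axial symmetry of a continuous representative on the shell -/

/-- **Axial symmetry passes to a continuous representative on the shell.** If every slice
`u(t, ·)`, `-R² < t < 0`, is axisymmetric (pointwise), `4 ≤ R²`, and `V` is continuous on
`Q̃ = 𝒞(1/4,3;2) × ]-4,0[` with `u = V` a.e. there, then `V(t, R_θ x) = R_θ V(t, x)` at every
point of `Q̃`: the space–time rotation `(t, x) ↦ (t, R_θ x)` preserves Lebesgue measure and `Q̃`,
so the identity holds a.e. on `Q̃`, and both sides are continuous on the open set `Q̃`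
(the argument of `SereginSverak2009.repr_rotZ`). [folklore] -/
theorem isAxisymmetricOn_shell_of_continuousOn {R : ℝ} (hR : (2 : ℝ) ^ 2 ≤ R ^ 2)
    {u V : ℝ → (EuclideanSpace ℝ (Fin 3)) → (EuclideanSpace ℝ (Fin 3))} (haxi : ∀ t ∈ Ioo (-R ^ 2) 0, IsAxisymmetric (u t))
    (hVc : ContinuousOn (uncurry V) (shellCyl (1 / 4) 3 2 2))
    (hae : uncurry u =ᵐ[volume.restrict (shellCyl (1 / 4) 3 2 2)] uncurry V) :
    IsAxisymmetricOn (shellCyl (1 / 4) 3 2 2) V := by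
  intro θ
  set S : Set (ℝ × (EuclideanSpace ℝ (Fin 3))) := shellCyl (1 / 4) 3 2 2 with hS
  have hSo : IsOpen S := isOpen_shellCyl _ _ _ _
  -- the space–time rotation and its invariances
  set Φ : ℝ × (EuclideanSpace ℝ (Fin 3)) → ℝ × (EuclideanSpace ℝ (Fin 3)) := Prod.map id (rotZLIE θ) with hΦ_def
  have hΦ : ∀ z, Φ z = (z.1, rotZ θ z.2) := fun z => rfl
  have hΦc : Continuous Φ := continuous_id.prodMap (rotZLIE θ).continuous
  have hΦmp : MeasurePreserving Φ (volume : Measure (ℝ × (EuclideanSpace ℝ (Fin 3)))) volume :=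
    (MeasurePreserving.id (volume : Measure ℝ)).prod (rotZLIE θ).measurePreserving
  have hpre : Φ ⁻¹' S = S := by
    ext z
    rw [mem_preimage, hΦ, hS, rotZ_mem_shellCyl_iff]
  have hΦr : MeasurePreserving Φ (volume.restrict S) (volume.restrict S) := by
    have h := hΦmp.restrict_preimage hSo.measurableSet
    rwa [hpre] at h
  have hmaps : MapsTo Φ S S := fun z hz => by
    rw [hΦ, hS, rotZ_mem_shellCyl_iff]
    exact hz
  -- `V ∘ Φ = R_θ ∘ V` almost everywhere on the shell
  have h1 : (uncurry V ∘ Φ) =ᵐ[volume.restrict S] (uncurry u ∘ Φ) :=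
    hΦr.quasiMeasurePreserving.ae_eq_comp hae.symm
  have h2 : (uncurry u ∘ Φ) =ᵐ[volume.restrict S] fun z => rotZ θ (uncurry u z) := by
    filter_upwards [ae_restrict_mem hSo.measurableSet] with z hz
    rw [hS, mem_shellCyl] at hz
    have ht : z.1 ∈ Ioo (-R ^ 2) 0 := ⟨by linarith [hz.1.1], hz.1.2⟩
    simp only [comp_apply, hΦ, uncurry_apply_pair]
    exact haxi z.1 ht θ z.2
  have h3 : (fun z => rotZ θ (uncurry u z)) =ᵐ[volume.restrict S] fun z => rotZ θ (uncurry V z) := by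
    filter_upwards [hae] with z hz
    rw [hz]
  have hae' : (uncurry V ∘ Φ) =ᵐ[volume.restrict S] fun z => rotZ θ (uncurry V z) :=
    (h1.trans h2).trans h3
  -- both sides are continuous on the open shell, hence equal there
  have hc1 : ContinuousOn (uncurry V ∘ Φ) S := hVc.comp hΦc.continuousOn hmaps
  have hc2 : ContinuousOn (fun z => rotZ θ (uncurry V z)) S :=
    (rotZLIE θ).continuous.comp_continuousOn hVc
  have heq : EqOn (uncurry V ∘ Φ) (fun z => rotZ θ (uncurry V z)) S :=
    Measure.eqOn_open_of_ae_eq hae' hSo hc1 hc2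
  intro z hz
  have key := heq hz
  simp only [comp_apply, hΦ, uncurry] at key
  exact key

/-! ### The reduction -/

/-- **`OffAxisSmoothRepresentative` from the interior regularity of bounded solutions**
(Seregin–Šverák 2009, §2 p. 8, applied around every point of `Q̃`, where (r3) bounds the
velocity; module docstring). Given `NSBoundedHigherRegularity`, every pair `(u, p)` of the class
`IsTypeIAxisymmetricSolutionOn 3` has a representative `V`, `u = V` a.e. on
`Q̃ = 𝒞(1/4, 3; 2) × ]-2², 0[`, with `(V, p)` in the hypothesis class of Seregin–Zajaczkowski 2007,
Prop. 4.1 on `Q̃`: suitable (Remark 3.4, `SuitableOfBounded_holds`, transported by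
`IsSuitableWeakSolutionOn.congr_ae`), axially symmetric at every point (by continuity,
`isAxisymmetricOn_shell_of_continuousOn`), with `C^∞` slices and locally Hölder spatial
derivatives (`NSBoundedHigherRegularity.exists_smooth_representative` on the open set `Q̃`, fed by
`IsTypeIAxisymmetricSolutionOn.exists_nhds_bound` and `p ∈ L_{3/2}(Q(0,3))`).
[cite: SereginSverak2009, §2 p. 8 with §3 (r3), Remark 3.4 and proof of Prop. 3.7 (as15) (arXiv pp. 8–10)] -/
theorem offAxisSmoothRepresentative_of_higherRegularity (hH : NSBoundedHigherRegularity) :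
    OffAxisSmoothRepresentative := by
  intro u p h3
  have hle : shellCylOpens (1 / 4) 3 2 2 ≤ parCylOpens (0 : ℝ × (EuclideanSpace ℝ (Fin 3))) 3 :=
    shellCylOpens_tilde_le_parCylOpens_three
  have hsol : IsDistributionalNSSolutionOn (shellCylOpens (1 / 4) 3 2 2) 1 0 u p :=
    h3.distributional.of_le hle
  have hbd : ∀ z ∈ ((shellCylOpens (1 / 4) 3 2 2 : Opens (ℝ × (EuclideanSpace ℝ (Fin 3)))) : Set (ℝ × (EuclideanSpace ℝ (Fin 3)))),
      ∃ U ∈ 𝓝 z, ∃ M : ℝ, ∀ᵐ w ∂(volume.restrict U), ‖u w.1 w.2‖ ≤ M :=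
    fun z hz => h3.exists_nhds_bound (shellCyl_tilde_subset_parCyl_three hz)
  have hp : ∀ z ∈ ((shellCylOpens (1 / 4) 3 2 2 : Opens (ℝ × (EuclideanSpace ℝ (Fin 3)))) : Set (ℝ × (EuclideanSpace ℝ (Fin 3)))),
      ∃ U ∈ 𝓝 z, ∫⁻ w in U, ‖p w.1 w.2‖ₑ ^ (3 / 2 : ℝ) < ∞ :=
    fun z hz => h3.exists_nhds_pressure (shellCyl_tilde_subset_parCyl_three hz)
  obtain ⟨V, hae, hVc, hCD, hHol⟩ := hH.exists_smooth_representative hsol hbd hp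
  rw [coe_shellCylOpens] at hae hVc hCD hHol
  have hsuit : IsSuitableWeakSolutionOn (shellCylOpens (1 / 4) 3 2 2) 1 0 V p :=
    ((h3.isSuitable SuitableOfBounded_holds).of_le hle).congr_ae hae
      (Eventually.of_forall fun _ => rfl)
  have haxi : IsAxisymmetricOn (shellCyl (1 / 4) 3 2 2) V :=
    isAxisymmetricOn_shell_of_continuousOn (R := 3) (by norm_num) h3.axisymmetric hVc hae
  refine ⟨V, ⟨hsuit, haxi, hCD, fun n z hz => ?_⟩, hae⟩
  obtain ⟨U, hUo, hzU, -, C, α, hα, hHU⟩ := hHol n z hz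
  exact ⟨U, hUo.mem_nhds hzU, C, α, hα, hHU.mono inter_subset_left⟩

/-! ### Consequences: the trust base of (as15) and of the display after it -/

/-- **(as15) from Seregin–Zajaczkowski 2007, Prop. 4.1, and the interior regularity of bounded
solutions**: composing `offAxisSmoothRepresentative_of_higherRegularity` with the accepted
`unitScaleOffAxisBound_of_offAxisSupBound`, the named fact `UnitScaleOffAxisBound` ((as15) for the
pairs under the conditions of Thm. 3.1, arXiv p. 10) follows from `OffAxisSupBound` (Prop. 4.1 for
the smooth class) and `NSBoundedHigherRegularity`.
[cite: SereginSverak2009, proof of Prop. 3.7, (as15) (arXiv p. 10)] -/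
theorem unitScaleOffAxisBound_of_offAxisSupBound_of_higherRegularity (h41 : OffAxisSupBound)
    (hH : NSBoundedHigherRegularity) : UnitScaleOffAxisBound :=
  unitScaleOffAxisBound_of_offAxisSupBound h41 (offAxisSmoothRepresentative_of_higherRegularity hH)

/-- **The display after (as15)** ("After making inverse scaling in (as15), we find …", arXiv
p. 10; the named fact `OffAxisBound`) from the same two inputs, through the accepted
`offAxisBound_of_unitScaleOffAxisBound`. [cite: SereginSverak2009, proof of Prop. 3.7 (arXiv p. 10)] -/
theorem offAxisBound_of_offAxisSupBound_of_higherRegularity (h41 : OffAxisSupBound)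
    (hH : NSBoundedHigherRegularity) : OffAxisBound :=
  offAxisBound_of_unitScaleOffAxisBound
    (unitScaleOffAxisBound_of_offAxisSupBound_of_higherRegularity h41 hH)

end SereginSverak2009

end Literature.Analysis.FluidPDE
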